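import Literature.Analysis.FunctionSpaces.MaximalLipschitz
import Literature.Analysis.FunctionSpaces.MollificationLp
import Literature.Analysis.SingularIntegrals.Marcinkiewicz
import Literature.Analysis.Fourier.GradientBoundSchwartz
import Mathlib.Analysis.Calculus.Rademacher
import Mathlib.MeasureTheory.Covering.BesicovitchVectorSpace
import Mathlib.Analysis.Calculus.ParametricIntegral
import Mathlib.Analysis.Calculus.FDeriv.Measurable
import HarnessLib

/-!
# Interpolation of `Ẇ^{1,p}` bounds between `p = 1` and `p = 2`: discharge of
`gradientLpBound_interpolation`

Analysis/Fourier proof file; sibling of `SobolevMultiplierBound` (the named fact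
`Literature.Analysis.Fourier.gradientLpBound_interpolation`: for a bounded, entrywise measurable
matrix symbol `M` on `ℝᵈ`, an `Ẇ^{1,1}` bound `Σⱼ ‖M(D)∂ⱼφ‖₁ ≤ c₁ Σⱼ ‖∂ⱼφ‖₁` and an `Ẇ^{1,2}`
bound with constant `c₂` on `C_c^∞` test functions give, for every `1 < p < 2`, an `Ẇ^{1,p}`
bound with some constant `c` — Rauch's "Interpolating, (5) is valid for `Lᵖ`, `1 < p < 2`"
[Rauch1986, Proof of Theorem p. 483], i.e. the interpolation property of the homogeneous Sobolev
spaces [Badr2009, Thm 1.4, Cor. 5.9]). This file PROVES it: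
`gradientLpBound_interpolation_holds`.

## The argument (as formalised)

The abstract statement `(Ẇ¹₁, Ẇ¹₂)_{θ,p} = Ẇ¹_p` of [Badr2009] rests on the Calderón–Zygmund
decomposition of Sobolev functions [Badr2009, §5, Prop. 5.6]: at height `α`, a Sobolev function
splits as `f = g + b` with `g` Lipschitz, `‖∇g‖_∞ ≲ α`, and `b` carried by the bad set
`{M(|∇f|) > α}` (`M` the Hardy–Littlewood maximal function). We run this decomposition
directly on the test function and feed the two pieces into the two hypotheses (the classical
proof of the Marcinkiewicz theorem with the cut `f = f 1_{|f|>α} + f 1_{|f|≤α}` replaced by the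
gradient-preserving Lipschitz truncation), which avoids `K`-functionals altogether:

1. **Lipschitz truncation** (`exists_lipschitz_truncation`). For `φ ∈ C_c^∞(ℝᵈ; ℂᵏ)`, `d ≥ 1`,
   and `t > 0` let `F = {M(‖Dφ‖) ≤ t}`. By the pointwise maximal inequality
   `‖φ(x) - φ(y)‖ ≲ ‖x - y‖ (M(x) + M(y))` (tree: `MaximalLipschitz`,
   `lipschitzOnWith_of_maximal_le`) `φ` is `2^{2d+6}t`-Lipschitz on `F`; a Lipschitz extension
   `g` of `φ|_F` (Mathlib `LipschitzOnWith.extend_finite_dimension`, constant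
   `K = c_ext 2^{2d+6} t`) and `b = φ - g` give `φ = g + b` with `‖Dg‖ ≤ K` everywhere,
   `Dg = Dφ` a.e. on `F` and `Db = 0` a.e. on `F` — because a Lipschitz map has zero derivative
   at a.e. point of its zero set (`ae_fderiv_eq_zero_of_lipschitzWith`: Rademacher's theorem and
   Lebesgue's density theorem) — and `b` is compactly supported because `M(‖Dφ‖) ≤ t` outside a
   large ball (`exists_radius_maximalFunction_le`). Hence
   `∫ ‖∂_l g‖² ≤ ∫_F ‖Dφ‖² + K² |Fᶜ|` and `∫ ‖∂_l b‖ ≤ ∫_{Fᶜ} ‖Dφ‖ + K |Fᶜ|`.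
2. **Weak-type splitting** (`measure_lt_norm_multiplierOp_partialDeriv_le`). For ANY
   decomposition `φ = g + b` into compactly supported Lipschitz maps,
   `|{|M(D)∂ⱼφ| > t}| ≤ (t/3)⁻² (c₂ Σ_l ‖∂_l g‖₂)² + (t/3)⁻¹ c₁ Σ_l ‖∂_l b‖₁`: mollify
   (`g_n = ρ_n ⋆ g`, `b_n = ρ_n ⋆ b`, `φ_n = ρ_n ⋆ φ = g_n + b_n`, all `C_c^∞`), split
   `M(D)∂ⱼφ = M(D)∂ⱼ(φ - φ_n) + M(D)∂ⱼg_n + M(D)∂ⱼb_n`, apply Chebyshev with the `L²`, `L²`,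
   `L¹` bounds of the hypotheses, `∂_l(ρ ⋆ u) = ρ ⋆ ∂_l u` for Lipschitz `u`
   (`partialDeriv_normed_convolution_of_lipschitzWith`, differentiation under the integral sign)
   and Young's inequality (tree: `eLpNorm_normed_convolution_le_haar`), and let `n → ∞`
   (`∂_lφ_n → ∂_lφ` in `L²`, tree: `tendsto_eLpNorm_normed_convolution_sub_self`).
3. **Level-set integration** (`lintegral_rpow_multiplierOp_partialDeriv_le`). With `F` as in 1
   at level `t`, `F ⊆ {‖Dφ‖ ≤ t}` and `Fᶜ = {t < M}`, so by 1–2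
   `|{|M(D)∂ⱼφ| > t}| ≲ t⁻² ∫_{‖Dφ‖≤t} ‖Dφ‖² + |{M > t}| + t⁻¹ ∫_{M>t} M`; integrating against
   `p t^{p-1} dt` (layer cake, Mathlib) the three terms give `∫ ‖Dφ‖^p` by the two Tonelli
   computations of the tree's `Marcinkiewicz` file (`lintegral_rpow_mul_lintegral_indicator_le/lt`)
   and the maximal theorem (`lintegral_maximalFunction_rpow_le`), `1 < p < 2`.
4. `gradientLpBound_interpolation_holds`: `‖Dφ‖_p ≤ Σ_l ‖∂_lφ‖_p`, sum over `j`; the guard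
   (integrability of `M · 𝓕(∂ⱼφ)`) is that of the `Ẇ^{1,1}` hypothesis; `d = 0` is empty.

## Design notes

* Everything is proved; no definitions and no named facts are introduced. Constants are
  explicit but immaterial (only finiteness is used); the final constant depends on
  `d, k, p, c₁, c₂` (through `lipschitzExtensionConstant (Fin k → ℂ)` and the maximal constant).
* The `Ẇ^{1,2}` hypothesis is used as stated (it also follows from boundedness of `M`,
  `hasGradientLpBoundWith_two_of_bounded`); boundedness and measurability of `M` enter only
  through the additivity and continuity of `M(D)` on test functions (`MultiplierOpL2`,
  `GradientBoundSchwartz`).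

## References

* [Rauch1986] J. Rauch, Comm. Math. Phys. 106 (1986) 481–484, Proof of Theorem p. 483, (5).
* [Badr2009] N. Badr, *Real interpolation of Sobolev spaces*, Math. Scand. 105 (2009) 235–264
  (arXiv:0705.2216): Thm 1.4, Cor. 5.9, and §5 Prop. 5.6 (Calderón–Zygmund lemma for Sobolev
  functions: the functions `g`, `b`).
* [Stein1971] E. M. Stein, *Singular integrals and differentiability properties of functions*,
  Princeton (1970): Ch. I §1 Thm 1 (maximal function), Ch. I §4 Thm 5 (the Marcinkiewicz
  argument).
-/

noncomputable section

open MeasureTheory Metric Set Filter Topology Function ContinuousLinearMap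
open scoped ENNReal NNReal Convolution FourierTransform ContDiff

namespace Literature.Analysis.Fourier

open Literature.Analysis.SingularIntegrals Literature.Analysis.FunctionSpaces

section General

variable {E : Type*} [NormedAddCommGroup E] [NormedSpace ℝ E] [FiniteDimensional ℝ E]
  [MeasurableSpace E] [BorelSpace E] (μ : Measure E) [μ.IsAddHaarMeasure]

/-! ### Two comparisons for the maximal function -/

/-- A lower semicontinuous size is dominated by its maximal function everywhere:
`G(x) ≤ M G(x)` (averages over small balls). [folklore] -/
theorem le_maximalFunction_of_lowerSemicontinuous {G : E → ℝ≥0∞} (hG : LowerSemicontinuous G)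
    (x : E) : G x ≤ maximalFunction μ G x := by
  refine le_of_forall_lt_imp_le_of_dense fun c hc => ?_
  have hopen : IsOpen {y | c < G y} := hG.isOpen_preimage c
  obtain ⟨r, hr, hball⟩ := Metric.isOpen_iff.1 hopen x hc
  have hV0 : μ (ball x r) ≠ 0 := (measure_ball_pos μ x hr).ne'
  have hVt : μ (ball x r) ≠ ⊤ := measure_ball_lt_top.ne
  calc c = (μ (ball x r))⁻¹ * ∫⁻ _ in ball x r, c ∂μ := by
        rw [setLIntegral_const, mul_comm c, ← mul_assoc, ENNReal.inv_mul_cancel hV0 hVt, one_mul]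
    _ ≤ (μ (ball x r))⁻¹ * ∫⁻ y in ball x r, G y ∂μ := by
        gcongr 1
        exact setLIntegral_mono' measurableSet_ball fun y hy => (hball hy).le
    _ ≤ maximalFunction μ G x := average_le_maximalFunction μ G x hr

omit [NormedSpace ℝ E] [FiniteDimensional ℝ E] in
/-- Decay of the maximal function away from the support: if `G` vanishes outside the closed ball
of radius `R` and `R + s ≤ ‖x‖`, then `M G(x) ≤ μ(B(0,s))⁻¹ ∫ G`. [folklore] -/
theorem maximalFunction_le_of_norm_le {G : E → ℝ≥0∞} {R s : ℝ}
    (hG : ∀ y, R < ‖y‖ → G y = 0) {x : E} (hx : R + s ≤ ‖x‖) :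
    maximalFunction μ G x ≤ (μ (ball (0 : E) s))⁻¹ * ∫⁻ y, G y ∂μ := by
  rw [maximalFunction_def]
  refine iSup₂_le fun r hr => ?_
  by_cases hrs : r ≤ s
  · have h0 : ∫⁻ y in ball x r, G y ∂μ = 0 := by
      refine (setLIntegral_congr_fun measurableSet_ball fun y hy => hG y ?_).trans (by simp)
      rw [mem_ball_iff_norm] at hy
      have : ‖x‖ ≤ ‖y‖ + ‖y - x‖ := by
        calc ‖x‖ = ‖y - (y - x)‖ := by rw [sub_sub_cancel]
          _ ≤ ‖y‖ + ‖y - x‖ := norm_sub_le _ _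
      linarith
    simp [h0]
  · push Not at hrs
    calc (μ (ball x r))⁻¹ * ∫⁻ y in ball x r, G y ∂μ
        ≤ (μ (ball x s))⁻¹ * ∫⁻ y, G y ∂μ :=
          mul_le_mul' (ENNReal.inv_le_inv' (measure_mono (ball_subset_ball hrs.le)))
            (setLIntegral_le_lintegral _ _)
      _ = (μ (ball (0 : E) s))⁻¹ * ∫⁻ y, G y ∂μ := by rw [Measure.addHaar_ball_center]

/-! ### The gradient of a Lipschitz map vanishes a.e. on its zero set -/

/-- **A Lipschitz map into a finite-dimensional space has zero derivative at almost every point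
of its zero set** (Rademacher's theorem and Lebesgue's density theorem: at a density point of
`{b = 0}` where `b` is differentiable, a non-zero derivative would keep `b ≠ 0` on a ball of
proportional radius inside every small ball around the point). [folklore] -/
theorem ae_fderiv_eq_zero_of_lipschitzWith {F' : Type*} [NormedAddCommGroup F']
    [NormedSpace ℝ F'] [FiniteDimensional ℝ F'] {b : E → F'} {K : ℝ≥0} (hb : LipschitzWith K b) :
    ∀ᵐ x ∂μ, b x = 0 → fderiv ℝ b x = 0 := by
  set Z : Set E := {x | b x = 0} with hZ
  have hZc : IsClosed Z := isClosed_eq hb.continuous continuous_const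
  have hdens := Besicovitch.ae_tendsto_measure_inter_div μ Z
  have hdiff : ∀ᵐ x ∂μ.restrict Z, DifferentiableAt ℝ b x :=
    ae_restrict_of_ae (hb.ae_differentiableAt (μ := μ))
  have hmem : ∀ᵐ x ∂μ.restrict Z, x ∈ Z := ae_restrict_mem hZc.measurableSet
  refine ae_imp_of_ae_restrict ?_
  filter_upwards [hdens, hdiff, hmem] with x hx hdx hxZ
  set L : E →L[ℝ] F' := fderiv ℝ b x with hL
  by_contra hL0
  -- a unit vector on which `L` is large
  obtain ⟨v, hv⟩ : ∃ v, L v ≠ 0 := by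
    by_contra h
    push Not at h
    exact hL0 (ContinuousLinearMap.ext fun v => by rw [h v]; rfl)
  have hv0 : v ≠ 0 := fun h => hv (by rw [h, map_zero])
  set u : E := ‖v‖⁻¹ • v with hu
  have hu1 : ‖u‖ = 1 := by
    rw [hu, norm_smul, norm_inv, norm_norm, inv_mul_cancel₀ (norm_ne_zero_iff.2 hv0)]
  set c : ℝ := ‖L u‖ with hc
  have hc0 : 0 < c := by
    rw [hc, hu, map_smul, norm_smul, norm_inv, norm_norm]
    exact mul_pos (inv_pos.2 (norm_pos_iff.2 hv0)) (norm_pos_iff.2 hv)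
  have hLc : c ≤ ‖L‖ := by
    calc c = ‖L u‖ := hc
      _ ≤ ‖L‖ * ‖u‖ := L.le_opNorm u
      _ = ‖L‖ := by rw [hu1, mul_one]
  have hLpos : 0 < ‖L‖ := hc0.trans_le hLc
  -- the proportional radius `ρ ≤ 1/4`
  set ρ : ℝ := c / (4 * ‖L‖) with hρ
  have hρ0 : 0 < ρ := div_pos hc0 (by positivity)
  have hρ4 : ρ ≤ 1 / 4 := by
    rw [hρ, div_le_div_iff₀ (by positivity) (by norm_num : (0 : ℝ) < 4)]
    linarith
  -- differentiability with `ε = c/4`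
  have hder : HasFDerivAt b L x := hdx.hasFDerivAt
  rw [hasFDerivAt_iff_isLittleO_nhds_zero] at hder
  have hε := hder.bound (div_pos hc0 (by norm_num : (0 : ℝ) < 4))
  obtain ⟨δ, hδ, hδε⟩ := Metric.eventually_nhds_iff.1 hε
  -- for `0 < R' < δ`, the ratio at radius `R'` is at most `1 - q`
  set n := Module.finrank ℝ E with hn
  set q : ℝ≥0∞ := ENNReal.ofReal ((ρ / 2) ^ n) with hq
  have hq0 : q ≠ 0 := (ENNReal.ofReal_pos.2 (by positivity)).ne'
  have hq1 : q ≤ 1 := by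
    rw [hq]
    refine ENNReal.ofReal_le_one.2 (pow_le_one₀ (by positivity) ?_)
    linarith
  have hratio : ∀ R' ∈ Ioo (0 : ℝ) δ,
      μ (Z ∩ closedBall x R') / μ (closedBall x R') + q ≤ 1 := by
    intro R' hR'
    set r : ℝ := R' / 2 with hr
    have hr0 : 0 < r := by rw [hr]; linarith [hR'.1]
    have hR'2 : R' = 2 * r := by rw [hr]; ring
    -- the small ball misses `Z`
    set S : Set E := closedBall (x + r • u) (ρ * r) with hS
    have hSZ : Disjoint S Z := by
      rw [Set.disjoint_left]
      intro y hy hyZ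
      rw [hS, mem_closedBall, dist_eq_norm] at hy
      set h : E := y - x with hh
      set e : E := h - r • u with he
      have he' : ‖e‖ ≤ ρ * r := by
        rw [he, hh, show y - x - r • u = y - (x + r • u) by abel]; exact hy
      have hh_le : ‖h‖ ≤ 5 / 4 * r := by
        calc ‖h‖ = ‖r • u + e‖ := by rw [he]; abel_nf
          _ ≤ ‖r • u‖ + ‖e‖ := norm_add_le _ _
          _ ≤ r + ρ * r := by
              rw [norm_smul, Real.norm_eq_abs, abs_of_pos hr0, hu1, mul_one]
              exact add_le_add le_rfl he'
          _ ≤ 5 / 4 * r := by nlinarith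
      have hhδ : ‖h‖ < δ := by
        have : R' < δ := hR'.2
        nlinarith
      have hLh : 3 / 4 * (r * c) ≤ ‖L h‖ := by
        have h1 : L h = r • L u + L e := by
          rw [show h = r • u + e by rw [he]; abel, map_add, map_smul]
        have h2 : ‖L e‖ ≤ ‖L‖ * (ρ * r) := (L.le_opNorm e).trans (by gcongr)
        have h3 : ‖L‖ * (ρ * r) = r * c / 4 := by
          rw [hρ]; field_simp
        calc 3 / 4 * (r * c) = ‖r • L u‖ - r * c / 4 := by
              rw [norm_smul, Real.norm_eq_abs, abs_of_pos hr0, ← hc]; ring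
          _ ≤ ‖r • L u‖ - ‖L e‖ := by linarith
          _ ≤ ‖r • L u + L e‖ := by
              have := norm_sub_le (r • L u + L e) (L e)
              rw [add_sub_cancel_right] at this
              linarith
          _ = ‖L h‖ := by rw [h1]
      have hTaylor : ‖b (x + h) - b x - L h‖ ≤ c / 4 * ‖h‖ := by
        have := hδε (y := h) (by rwa [dist_zero_right])
        simpa only [norm_norm] using this
      have hbx : b x = 0 := hxZ
      have hby : b y = 0 := hyZ
      have hxy : x + h = y := by rw [hh]; abel
      rw [hxy, hby, hbx, sub_zero, zero_sub, norm_neg] at hTaylor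
      nlinarith
    -- `S ⊆ closedBall x R'`
    have hSB : S ⊆ closedBall x R' := by
      intro y hy
      rw [hS, mem_closedBall, dist_eq_norm] at hy
      rw [mem_closedBall, dist_eq_norm, hR'2]
      calc ‖y - x‖ = ‖(y - (x + r • u)) + r • u‖ := by congr 1; abel
        _ ≤ ‖y - (x + r • u)‖ + ‖r • u‖ := norm_add_le _ _
        _ ≤ ρ * r + r := by
            rw [norm_smul, Real.norm_eq_abs, abs_of_pos hr0, hu1, mul_one]
            exact add_le_add hy le_rfl
        _ ≤ 2 * r := by nlinarith
    -- measures
    have hB0 : μ (closedBall x R') ≠ 0 := (measure_closedBall_pos μ x hR'.1).ne'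
    have hBt : μ (closedBall x R') ≠ ⊤ := measure_closedBall_lt_top.ne
    have hSmeas : μ S = q * μ (closedBall x R') := by
      rw [hS, hq, Measure.addHaar_closedBall μ _ (by positivity : (0 : ℝ) ≤ ρ * r),
        Measure.addHaar_closedBall μ _ hR'.1.le, ← mul_assoc, ← ENNReal.ofReal_mul (by positivity)]
      congr 2
      rw [hR'2, ← mul_pow]
      congr 1
      ring
    have hsum : μ (Z ∩ closedBall x R') + μ S ≤ μ (closedBall x R') := by
      rw [← measure_union _ measurableSet_closedBall]
      · exact measure_mono (union_subset inter_subset_right hSB)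
      · exact Set.disjoint_left.2 fun y hy hyS => (Set.disjoint_left.1 hSZ hyS) hy.1
    calc μ (Z ∩ closedBall x R') / μ (closedBall x R') + q
        = (μ (Z ∩ closedBall x R') + μ S) / μ (closedBall x R') := by
          rw [ENNReal.add_div, hSmeas, ENNReal.mul_div_cancel_right hB0 hBt]
      _ ≤ μ (closedBall x R') / μ (closedBall x R') := by gcongr
      _ = 1 := ENNReal.div_self hB0 hBt
  -- contradiction with density `1`
  have hlt : (1 : ℝ≥0∞) - q < 1 := ENNReal.sub_lt_self ENNReal.one_ne_top one_ne_zero hq0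
  have hev1 := hx.eventually_const_lt hlt
  have hev2 : ∀ᶠ R' in 𝓝[>] (0 : ℝ), R' ∈ Ioo 0 δ := Ioo_mem_nhdsGT hδ
  obtain ⟨R', h1, h2⟩ := (hev1.and hev2).exists
  have h3 := hratio R' h2
  have h4 : (1 : ℝ≥0∞) < μ (Z ∩ closedBall x R') / μ (closedBall x R') + q :=
    (ENNReal.sub_lt_iff_lt_right (ne_top_of_le_ne_top ENNReal.one_ne_top hq1) hq1).1 h1
  exact absurd (h4.trans_le h3) (lt_irrefl _)

end General

/-! ### Mollification of Lipschitz maps: `∂_l(ρ ⋆ v) = ρ ⋆ ∂_l v` -/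

section Mollify

variable {d : ℕ} {F' : Type*} [NormedAddCommGroup F'] [NormedSpace ℝ F'] [FiniteDimensional ℝ F']
  [CompleteSpace F'] [MeasurableSpace F'] [BorelSpace F']

/-- **Mollification commutes with the partial derivatives of a Lipschitz map**: for `v` Lipschitz
(so that `∂_l v(y) = Dv(y)[e_l]` exists for a.e. `y`, Rademacher) and a normalised bump `ρ`,
`∂_l(ρ ⋆ v)(x) = (ρ ⋆ ∂_l v)(x)` for every `x` (differentiation under the integral sign along the
line `s ↦ x + s e_l`, dominated by the Lipschitz bound). [folklore] -/
theorem partialDeriv_normed_convolution_of_lipschitzWith {v : EuclideanSpace ℝ (Fin d) → F'}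
    {K : ℝ≥0} (hv : LipschitzWith K v) (ρ : ContDiffBump (0 : EuclideanSpace ℝ (Fin d)))
    (l : Fin d) (x : EuclideanSpace ℝ (Fin d)) :
    partialDeriv l (ρ.normed volume ⋆[lsmul ℝ ℝ, volume] v) x =
      (ρ.normed volume ⋆[lsmul ℝ ℝ, volume] partialDeriv l v) x := by
  set e : EuclideanSpace ℝ (Fin d) := EuclideanSpace.single l 1 with he
  set w : EuclideanSpace ℝ (Fin d) → F' := ρ.normed volume ⋆[lsmul ℝ ℝ, volume] v with hw
  have hvli : LocallyIntegrable v volume := hv.continuous.locallyIntegrable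
  have hwC : ContDiff ℝ 1 w :=
    ρ.hasCompactSupport_normed.contDiff_convolution_left _ ρ.contDiff_normed hvli
  -- the smooth side
  have hpath : HasDerivAt (fun s : ℝ => x + s • e) e 0 := by
    simpa using ((hasDerivAt_id (0 : ℝ)).smul_const e).const_add x
  have h1 : HasDerivAt (fun s : ℝ => w (x + s • e)) (partialDeriv l w x) 0 := by
    have hwd : HasFDerivAt w (fderiv ℝ w (x + (0 : ℝ) • e)) (x + (0 : ℝ) • e) :=
      ((hwC.differentiable one_ne_zero) _).hasFDerivAt
    have h := hwd.comp_hasDerivAt (0 : ℝ) hpath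
    rw [zero_smul, add_zero] at h
    exact h
  -- the parametric integral side
  have hrepr : (fun s : ℝ => w (x + s • e)) =
      fun s : ℝ => ∫ t, ρ.normed volume t • v (x + s • e - t) := by
    funext s
    exact convolution_lsmul
  have hae : ∀ᵐ t ∂(volume : Measure (EuclideanSpace ℝ (Fin d))), DifferentiableAt ℝ v (x - t) :=
    (Measure.measurePreserving_sub_left volume x).quasiMeasurePreserving.ae
      (hv.ae_differentiableAt (μ := volume))
  have h2 : HasDerivAt (fun s : ℝ => w (x + s • e))
      (∫ t, ρ.normed volume t • partialDeriv l v (x - t)) 0 := by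
    rw [hrepr]
    refine (hasDerivAt_integral_of_dominated_loc_of_lip (μ := volume) (x₀ := (0 : ℝ))
      (F := fun (s : ℝ) t => ρ.normed volume t • v (x + s • e - t))
      (F' := fun t => ρ.normed volume t • partialDeriv l v (x - t))
      (bound := fun t => K * ‖e‖ * ρ.normed volume t) univ_mem ?_ ?_ ?_ ?_ ?_ ?_).2
    · refine Eventually.of_forall fun s => ?_
      exact ((ρ.continuous_normed.smul
        (hv.continuous.comp (continuous_const.sub continuous_id))).aestronglyMeasurable :)
    · simp only [zero_smul, add_zero]
      exact (ρ.continuous_normed.smul (hv.continuous.comp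
        (continuous_const.sub continuous_id))).integrable_of_hasCompactSupport
        ρ.hasCompactSupport_normed.smul_right
    · exact ρ.continuous_normed.aestronglyMeasurable.smul
        (((measurable_fderiv_apply_const ℝ v e).comp
          (measurable_const.sub measurable_id)).aestronglyMeasurable :)
    · refine Eventually.of_forall fun t => ?_
      refine (LipschitzWith.of_dist_le_mul fun s s' => ?_).lipschitzOnWith
      have hK' : ((Real.nnabs ((K : ℝ) * ‖e‖ * ρ.normed volume t) : ℝ≥0) : ℝ) =
          K * ‖e‖ * ρ.normed volume t := by
        rw [Real.coe_nnabs, abs_of_nonneg (mul_nonneg (by positivity) (ρ.nonneg_normed t))]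
      rw [hK', dist_eq_norm, ← smul_sub, norm_smul, Real.norm_of_nonneg (ρ.nonneg_normed t),
        Real.dist_eq]
      calc ρ.normed volume t * ‖v (x + s • e - t) - v (x + s' • e - t)‖
          ≤ ρ.normed volume t * (K * ‖(x + s • e - t) - (x + s' • e - t)‖) :=
            mul_le_mul_of_nonneg_left (hv.norm_sub_le _ _) (ρ.nonneg_normed t)
        _ = K * ‖e‖ * ρ.normed volume t * |s - s'| := by
            rw [show x + s • e - t - (x + s' • e - t) = (s - s') • e by rw [sub_smul]; abel,
              norm_smul, Real.norm_eq_abs]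
            ring
    · exact ρ.integrable_normed.const_mul (K * ‖e‖)
    · filter_upwards [hae] with t ht
      have hpath' : HasDerivAt (fun s : ℝ => x + s • e - t) e 0 := hpath.sub_const t
      have hcomp := ht.hasFDerivAt.comp_hasDerivAt_of_eq (0 : ℝ) hpath' (by simp)
      have hcomp' := hcomp.const_smul (ρ.normed volume t)
      rw [partialDeriv_apply]
      exact hcomp'
  rw [h1.unique h2]
  exact convolution_lsmul.symm

end Mollify

/-! ### Test-function algebra for `T_j ψ = M(D)∂ⱼψ` -/

section WeakBound

variable {d k k' : ℕ}

/-- `∂ⱼ(ψ₁ + ψ₂) = ∂ⱼψ₁ + ∂ⱼψ₂` for differentiable maps. [folklore] -/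
theorem partialDeriv_add {F : Type*} [NormedAddCommGroup F] [NormedSpace ℝ F]
    {ψ₁ ψ₂ : EuclideanSpace ℝ (Fin d) → F} (h₁ : Differentiable ℝ ψ₁) (h₂ : Differentiable ℝ ψ₂)
    (j : Fin d) : partialDeriv j (ψ₁ + ψ₂) = partialDeriv j ψ₁ + partialDeriv j ψ₂ := by
  funext x
  simp only [partialDeriv_apply, Pi.add_apply]
  rw [fderiv_add (h₁ x) (h₂ x)]
  rfl

/-- `∂ⱼ(ψ₁ - ψ₂) = ∂ⱼψ₁ - ∂ⱼψ₂` for differentiable maps. [folklore] -/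
theorem partialDeriv_sub {F : Type*} [NormedAddCommGroup F] [NormedSpace ℝ F]
    {ψ₁ ψ₂ : EuclideanSpace ℝ (Fin d) → F} (h₁ : Differentiable ℝ ψ₁) (h₂ : Differentiable ℝ ψ₂)
    (j : Fin d) : partialDeriv j (ψ₁ - ψ₂) = partialDeriv j ψ₁ - partialDeriv j ψ₂ := by
  funext x
  simp only [partialDeriv_apply, Pi.sub_apply]
  rw [fderiv_sub (h₁ x) (h₂ x)]
  rfl

/-- **Additivity of `ψ ↦ M(D)∂ⱼψ` on `C_c^∞` test functions** (the Bochner `𝓕⁻` is additive on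
integrable functions; bounded measurable symbol). [folklore] -/
theorem multiplierOp_partialDeriv_add {M : EuclideanSpace ℝ (Fin d) → Matrix (Fin k') (Fin k) ℂ}
    (hM : ∀ a b, Measurable fun ξ => M ξ a b) {C₀ : ℝ} (hC0 : 0 ≤ C₀)
    (hC : ∀ ξ a b, ‖M ξ a b‖ ≤ C₀) {ψ₁ ψ₂ : EuclideanSpace ℝ (Fin d) → Fin k → ℂ}
    (h₁ : ContDiff ℝ ∞ ψ₁) (h₁c : HasCompactSupport ψ₁) (h₂ : ContDiff ℝ ∞ ψ₂)
    (h₂c : HasCompactSupport ψ₂) (j : Fin d) :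
    multiplierOp M (partialDeriv j (ψ₁ + ψ₂)) =
      multiplierOp M (partialDeriv j ψ₁) + multiplierOp M (partialDeriv j ψ₂) := by
  obtain ⟨S₁, hS₁⟩ := exists_schwartz_coe_eq_partialDeriv h₁ h₁c j
  obtain ⟨S₂, hS₂⟩ := exists_schwartz_coe_eq_partialDeriv h₂ h₂c j
  have hadd : partialDeriv j (ψ₁ + ψ₂) = ⇑(S₁ + S₂) := by
    rw [partialDeriv_add (h₁.differentiable (by simp)) (h₂.differentiable (by simp)), ← hS₁, ← hS₂]
    rfl
  funext x
  rw [hadd, multiplierOp_schwartz_add hM hC0 hC, Pi.add_apply, hS₁, hS₂]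

/-- **The weak-type splitting.** Let `M` be bounded and entrywise measurable with the `Ẇ^{1,1}`
bound `c₁` and the `Ẇ^{1,2}` bound `c₂` on `C_c^∞` test functions, `φ ∈ C_c^∞`, and let
`φ = g + b` be ANY decomposition into compactly supported Lipschitz maps. Then for `t > 0`,
`|{|M(D)∂ⱼφ| > t}| ≤ (t/3)⁻² (c₂ Σ_l ‖∂_l g‖₂)² + (t/3)⁻¹ c₁ Σ_l ‖∂_l b‖₁`: mollify
`g_n = ρ_n ⋆ g`, `b_n = ρ_n ⋆ b`, `φ_n = ρ_n ⋆ φ = g_n + b_n` (all `C_c^∞`), split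
`M(D)∂ⱼφ = M(D)∂ⱼ(φ - φ_n) + M(D)∂ⱼg_n + M(D)∂ⱼb_n`, apply Chebyshev to each piece with the
`L²`, `L²`, `L¹` bounds, use `∂_l(ρ_n ⋆ u) = ρ_n ⋆ ∂_l u` and Young's inequality, and let `n → ∞`
(`∂_l φ_n → ∂_l φ` in `L²`). [folklore] -/
theorem measure_lt_norm_multiplierOp_partialDeriv_le
    {M : EuclideanSpace ℝ (Fin d) → Matrix (Fin k') (Fin k) ℂ}
    (hM : ∀ a b, Measurable fun ξ => M ξ a b) {C₀ : ℝ} (hC0 : 0 ≤ C₀)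
    (hC : ∀ ξ a b, ‖M ξ a b‖ ≤ C₀) {c₁ c₂ : ℝ≥0}
    (h₁ : HasGradientLpBoundWith 1 c₁ M) (h₂ : HasGradientLpBoundWith 2 c₂ M)
    {φ g b : EuclideanSpace ℝ (Fin d) → Fin k → ℂ} (hφ : ContDiff ℝ ∞ φ)
    (hφc : HasCompactSupport φ) {Kg Kb : ℝ≥0} (hg : LipschitzWith Kg g) (hb : LipschitzWith Kb b)
    (hgc : HasCompactSupport g) (hbc : HasCompactSupport b) (hsum : φ = g + b) (j : Fin d)
    {t : ℝ} (ht : 0 < t) :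
    volume {x | t < ‖multiplierOp M (partialDeriv j φ) x‖} ≤
      (ENNReal.ofReal t / 3)⁻¹ ^ (2 : ℝ) *
          ((c₂ : ℝ≥0∞) * ∑ l, eLpNorm (partialDeriv l g) 2 volume) ^ (2 : ℝ) +
        (ENNReal.ofReal t / 3)⁻¹ * ((c₁ : ℝ≥0∞) * ∑ l, eLpNorm (partialDeriv l b) 1 volume) := by
  -- abbreviations
  set T : (EuclideanSpace ℝ (Fin d) → Fin k → ℂ) → EuclideanSpace ℝ (Fin d) → Fin k' → ℂ :=
    fun ψ => multiplierOp M (partialDeriv j ψ) with hT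
  set ε : ℝ≥0∞ := ENNReal.ofReal t / 3 with hε
  have hε0 : ε ≠ 0 := (ENNReal.div_pos (ENNReal.ofReal_pos.2 ht).ne' (by norm_num)).ne'
  have hεtop : ε ≠ ⊤ := ENNReal.div_ne_top ENNReal.ofReal_ne_top (by norm_num)
  -- a mollifier sequence and the mollified functions
  obtain ⟨ρ, hρ, -⟩ := exists_contDiffBump_seq (E := EuclideanSpace ℝ (Fin d))
  obtain ⟨Kφ, hφL⟩ := hφ.lipschitzWith_of_hasCompactSupport hφc (by simp)
  have hsm : ∀ u : EuclideanSpace ℝ (Fin d) → Fin k → ℂ, Continuous u → ∀ n,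
      ContDiff ℝ ∞ ((ρ n).normed volume ⋆[lsmul ℝ ℝ, volume] u) := fun u hu n =>
    (ρ n).hasCompactSupport_normed.contDiff_convolution_left _ (ρ n).contDiff_normed
      hu.locallyIntegrable
  have hcs : ∀ u : EuclideanSpace ℝ (Fin d) → Fin k → ℂ, HasCompactSupport u → ∀ n,
      HasCompactSupport ((ρ n).normed volume ⋆[lsmul ℝ ℝ, volume] u) := fun u hu n =>
    (ρ n).hasCompactSupport_normed.convolution _ hu
  set φn : ℕ → EuclideanSpace ℝ (Fin d) → Fin k → ℂ :=
    fun n => (ρ n).normed volume ⋆[lsmul ℝ ℝ, volume] φ with hφn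
  set gn : ℕ → EuclideanSpace ℝ (Fin d) → Fin k → ℂ :=
    fun n => (ρ n).normed volume ⋆[lsmul ℝ ℝ, volume] g with hgn
  set bn : ℕ → EuclideanSpace ℝ (Fin d) → Fin k → ℂ :=
    fun n => (ρ n).normed volume ⋆[lsmul ℝ ℝ, volume] b with hbn
  -- `φ_n = g_n + b_n`
  have hsplit : ∀ n, φn n = gn n + bn n := by
    intro n
    have e1 : ConvolutionExists ((ρ n).normed volume) g (lsmul ℝ ℝ) volume :=
      (ρ n).hasCompactSupport_normed.convolutionExists_left _ (ρ n).continuous_normed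
        hg.continuous.locallyIntegrable
    have e2 : ConvolutionExists ((ρ n).normed volume) b (lsmul ℝ ℝ) volume :=
      (ρ n).hasCompactSupport_normed.convolutionExists_left _ (ρ n).continuous_normed
        hb.continuous.locallyIntegrable
    simp only [hφn, hgn, hbn, hsum]
    exact e1.distrib_add e2
  -- the three-term splitting of `T φ`
  have hTφ : ∀ n, T φ = T (φ - φn n) + T (gn n) + T (bn n) := by
    intro n
    have e1 : φ = (φ - φn n) + (gn n + bn n) := by rw [← hsplit n, sub_add_cancel]
    calc T φ = T ((φ - φn n) + (gn n + bn n)) := congrArg T e1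
      _ = T (φ - φn n) + T (gn n + bn n) :=
          multiplierOp_partialDeriv_add hM hC0 hC (hφ.sub (hsm φ hφ.continuous n))
            (hφc.sub (hcs φ hφc n)) ((hsm g hg.continuous n).add (hsm b hb.continuous n))
            ((hcs g hgc n).add (hcs b hbc n)) j
      _ = T (φ - φn n) + T (gn n) + T (bn n) := by
          rw [add_assoc]
          exact congrArg (T (φ - φn n) + ·) (multiplierOp_partialDeriv_add hM hC0 hC
            (hsm g hg.continuous n) (hcs g hgc n) (hsm b hb.continuous n) (hcs b hbc n) j)
  -- measurability of the pieces
  have hTmeas : ∀ ψ : EuclideanSpace ℝ (Fin d) → Fin k → ℂ, ContDiff ℝ ∞ ψ →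
      HasCompactSupport ψ → AEStronglyMeasurable (T ψ) volume := by
    intro ψ hψ hψc
    obtain ⟨S, hS⟩ := exists_schwartz_coe_eq_partialDeriv hψ hψc j
    simp only [hT]
    rw [← hS]
    exact (continuous_multiplierOp_schwartz hM hC0 hC S).aestronglyMeasurable
  -- the single-`j` bounds from the hypotheses
  have hB2 : ∀ ψ : EuclideanSpace ℝ (Fin d) → Fin k → ℂ, ContDiff ℝ ∞ ψ →
      HasCompactSupport ψ →
      eLpNorm (T ψ) 2 volume ≤ c₂ * ∑ l, eLpNorm (partialDeriv l ψ) 2 volume :=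
    fun ψ hψ hψc =>
      (Finset.single_le_sum (f := fun j => eLpNorm (multiplierOp M (partialDeriv j ψ)) 2 volume)
        (fun _ _ => zero_le) (Finset.mem_univ j)).trans (h₂ ψ hψ hψc).2
  have hB1 : ∀ ψ : EuclideanSpace ℝ (Fin d) → Fin k → ℂ, ContDiff ℝ ∞ ψ →
      HasCompactSupport ψ →
      eLpNorm (T ψ) 1 volume ≤ c₁ * ∑ l, eLpNorm (partialDeriv l ψ) 1 volume :=
    fun ψ hψ hψc =>
      (Finset.single_le_sum (f := fun j => eLpNorm (multiplierOp M (partialDeriv j ψ)) 1 volume)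
        (fun _ _ => zero_le) (Finset.mem_univ j)).trans (h₁ ψ hψ hψc).2
  -- Young's inequality for the mollified Lipschitz pieces
  have hYoung : ∀ (u : EuclideanSpace ℝ (Fin d) → Fin k → ℂ) (Ku : ℝ≥0), LipschitzWith Ku u →
      ∀ q : ℝ≥0∞, 1 ≤ q → ∀ n l,
      eLpNorm (partialDeriv l ((ρ n).normed volume ⋆[lsmul ℝ ℝ, volume] u)) q volume ≤
        eLpNorm (partialDeriv l u) q volume := by
    intro u Ku hu q hq n l
    have hfun : partialDeriv l ((ρ n).normed volume ⋆[lsmul ℝ ℝ, volume] u) =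
        (ρ n).normed volume ⋆[lsmul ℝ ℝ, volume] partialDeriv l u :=
      funext fun x => partialDeriv_normed_convolution_of_lipschitzWith hu (ρ n) l x
    rw [hfun]
    exact eLpNorm_normed_convolution_le_haar (ρ n)
      (measurable_fderiv_apply_const ℝ u _).aestronglyMeasurable hq
  -- Chebyshev at each `n`
  have hkey : ∀ n, volume {x | t < ‖T φ x‖} ≤
      ε⁻¹ ^ (2 : ℝ) * ((c₂ : ℝ≥0∞) * ∑ l, eLpNorm (partialDeriv l (φ - φn n)) 2 volume) ^ (2 : ℝ) +
      (ε⁻¹ ^ (2 : ℝ) * ((c₂ : ℝ≥0∞) * ∑ l, eLpNorm (partialDeriv l g) 2 volume) ^ (2 : ℝ) +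
        ε⁻¹ * ((c₁ : ℝ≥0∞) * ∑ l, eLpNorm (partialDeriv l b) 1 volume)) := by
    intro n
    have hm₁ := hTmeas (φ - φn n) (hφ.sub (hsm φ hφ.continuous n)) (hφc.sub (hcs φ hφc n))
    have hm₂ := hTmeas (gn n) (hsm g hg.continuous n) (hcs g hgc n)
    have hm₃ := hTmeas (bn n) (hsm b hb.continuous n) (hcs b hbc n)
    have hincl : {x | t < ‖T φ x‖} ⊆ {x | ε ≤ ‖T (φ - φn n) x‖ₑ} ∪ {x | ε ≤ ‖T (gn n) x‖ₑ} ∪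
        {x | ε ≤ ‖T (bn n) x‖ₑ} := by
      intro x hx
      simp only [mem_setOf_eq, mem_union] at hx ⊢
      by_contra hcon
      push Not at hcon
      obtain ⟨⟨e1, e2⟩, e3⟩ := hcon
      have hxT : T φ x = T (φ - φn n) x + T (gn n) x + T (bn n) x := by
        rw [hTφ n]; rfl
      have hlt : ‖T φ x‖ₑ < ENNReal.ofReal t := by
        calc ‖T φ x‖ₑ = ‖T (φ - φn n) x + T (gn n) x + T (bn n) x‖ₑ := by rw [hxT]
          _ ≤ ‖T (φ - φn n) x‖ₑ + ‖T (gn n) x‖ₑ + ‖T (bn n) x‖ₑ :=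
              (enorm_add_le _ _).trans (add_le_add (enorm_add_le _ _) le_rfl)
          _ < ε + ε + ε := ENNReal.add_lt_add (ENNReal.add_lt_add e1 e2) e3
          _ = ENNReal.ofReal t := by rw [hε, ENNReal.add_thirds]
      rw [← ofReal_norm, ENNReal.ofReal_lt_ofReal_iff ht] at hlt
      exact lt_asymm hx hlt
    calc volume {x | t < ‖T φ x‖}
        ≤ volume ({x | ε ≤ ‖T (φ - φn n) x‖ₑ} ∪ {x | ε ≤ ‖T (gn n) x‖ₑ} ∪
            {x | ε ≤ ‖T (bn n) x‖ₑ}) := measure_mono hincl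
      _ ≤ volume {x | ε ≤ ‖T (φ - φn n) x‖ₑ} + volume {x | ε ≤ ‖T (gn n) x‖ₑ} +
            volume {x | ε ≤ ‖T (bn n) x‖ₑ} :=
          (measure_union_le _ _).trans (add_le_add (measure_union_le _ _) le_rfl)
      _ ≤ ε⁻¹ ^ (2 : ℝ) * eLpNorm (T (φ - φn n)) 2 volume ^ (2 : ℝ) +
            ε⁻¹ ^ (2 : ℝ) * eLpNorm (T (gn n)) 2 volume ^ (2 : ℝ) +
            ε⁻¹ ^ (1 : ℝ) * eLpNorm (T (bn n)) 1 volume ^ (1 : ℝ) := by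
          gcongr
          · simpa using meas_ge_le_mul_pow_eLpNorm_enorm volume two_ne_zero ENNReal.ofNat_ne_top
              hm₁ hε0 (fun h => absurd h hεtop)
          · simpa using meas_ge_le_mul_pow_eLpNorm_enorm volume two_ne_zero ENNReal.ofNat_ne_top
              hm₂ hε0 (fun h => absurd h hεtop)
          · simpa using meas_ge_le_mul_pow_eLpNorm_enorm volume one_ne_zero ENNReal.one_ne_top
              hm₃ hε0 (fun h => absurd h hεtop)
      _ ≤ ε⁻¹ ^ (2 : ℝ) * ((c₂ : ℝ≥0∞) * ∑ l, eLpNorm (partialDeriv l (φ - φn n)) 2 volume) ^ (2 : ℝ) +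
            ε⁻¹ ^ (2 : ℝ) * ((c₂ : ℝ≥0∞) * ∑ l, eLpNorm (partialDeriv l g) 2 volume) ^ (2 : ℝ) +
            ε⁻¹ ^ (1 : ℝ) * ((c₁ : ℝ≥0∞) * ∑ l, eLpNorm (partialDeriv l b) 1 volume) ^ (1 : ℝ) := by
          gcongr
          · exact hB2 _ (hφ.sub (hsm φ hφ.continuous n)) (hφc.sub (hcs φ hφc n))
          · exact (hB2 _ (hsm g hg.continuous n) (hcs g hgc n)).trans (by
              gcongr with l
              exact hYoung g Kg hg 2 one_le_two n l)
          · exact (hB1 _ (hsm b hb.continuous n) (hcs b hbc n)).trans (by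
              gcongr with l
              exact hYoung b Kb hb 1 le_rfl n l)
      _ = _ := by rw [ENNReal.rpow_one, ENNReal.rpow_one, add_assoc]
  -- the first term tends to `0`
  have hX : Tendsto (fun n => ∑ l, eLpNorm (partialDeriv l (φ - φn n)) 2 volume) atTop (𝓝 0) := by
    rw [show (0 : ℝ≥0∞) = ∑ l : Fin d, 0 by simp]
    refine tendsto_finsetSum _ fun l _ => ?_
    have hfun : ∀ n, partialDeriv l (φ - φn n) =
        partialDeriv l φ - (ρ n).normed volume ⋆[lsmul ℝ ℝ, volume] partialDeriv l φ := by
      intro n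
      rw [partialDeriv_sub (hφ.differentiable (by simp))
        ((hsm φ hφ.continuous n).differentiable (by simp))]
      congr 1
      exact funext fun x => partialDeriv_normed_convolution_of_lipschitzWith hφL (ρ n) l x
    have heq : (fun n => eLpNorm (partialDeriv l (φ - φn n)) 2 volume) = fun n =>
        eLpNorm ((ρ n).normed volume ⋆[lsmul ℝ ℝ, volume] partialDeriv l φ - partialDeriv l φ)
          2 volume := by
      funext n
      rw [hfun n, eLpNorm_sub_comm]
    rw [heq]
    obtain ⟨S, hS⟩ := exists_schwartz_coe_eq_partialDeriv hφ hφc l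
    have hmem : MemLp (partialDeriv l φ) 2 volume := by
      rw [← hS]; exact S.memLp 2 volume
    exact tendsto_eLpNorm_normed_convolution_sub_self hρ one_le_two ENNReal.ofNat_ne_top hmem
  have hlim : Tendsto (fun n => ε⁻¹ ^ (2 : ℝ) *
      ((c₂ : ℝ≥0∞) * ∑ l, eLpNorm (partialDeriv l (φ - φn n)) 2 volume) ^ (2 : ℝ)) atTop (𝓝 0) := by
    have h1 := ENNReal.Tendsto.const_mul hX (Or.inr ENNReal.coe_ne_top) (a := (c₂ : ℝ≥0∞))
    rw [mul_zero] at h1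
    have h2 := ((ENNReal.continuous_rpow_const (y := (2 : ℝ))).tendsto (0 : ℝ≥0∞)).comp h1
    rw [ENNReal.zero_rpow_of_pos (by norm_num : (0 : ℝ) < 2)] at h2
    have h3 := ENNReal.Tendsto.const_mul h2
      (Or.inr (ENNReal.rpow_ne_top_of_nonneg (by norm_num) (ENNReal.inv_ne_top.2 hε0)))
      (a := ε⁻¹ ^ (2 : ℝ))
    rw [mul_zero] at h3
    exact h3
  have hlim' := hlim.add (tendsto_const_nhds
    (x := ε⁻¹ ^ (2 : ℝ) * ((c₂ : ℝ≥0∞) * ∑ l, eLpNorm (partialDeriv l g) 2 volume) ^ (2 : ℝ) +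
      ε⁻¹ * ((c₁ : ℝ≥0∞) * ∑ l, eLpNorm (partialDeriv l b) 1 volume)))
  rw [zero_add] at hlim'
  exact ge_of_tendsto' hlim' hkey

end WeakBound

/-! ### The Calderón–Zygmund decomposition of the test function (Lipschitz truncation) -/

section Decomposition

variable {d k : ℕ}

/-- A radius beyond which the maximal function of a compactly supported integrable size is
below a given level `t > 0` (dimension `≥ 1`). [folklore] -/
theorem exists_radius_maximalFunction_le (hd : 0 < d) {G : EuclideanSpace ℝ (Fin d) → ℝ≥0∞}
    (hI : ∫⁻ y, G y < ⊤) {R : ℝ} (hG : ∀ y, R < ‖y‖ → G y = 0) {t : ℝ} (ht : 0 < t) :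
    ∃ R', ∀ x : EuclideanSpace ℝ (Fin d), R' ≤ ‖x‖ → maximalFunction volume G x ≤ ENNReal.ofReal t := by
  set V : ℝ≥0∞ := volume (ball (0 : EuclideanSpace ℝ (Fin d)) 1) with hV
  have hV0 : V ≠ 0 := (measure_ball_pos volume _ zero_lt_one).ne'
  have hVt : V ≠ ⊤ := measure_ball_lt_top.ne
  set I : ℝ≥0∞ := ∫⁻ y, G y with hIdef
  have hVr : 0 < V.toReal := ENNReal.toReal_pos hV0 hVt
  set s : ℝ := I.toReal / (t * V.toReal) + 1 with hs
  have hs1 : 1 ≤ s := by rw [hs]; exact le_add_of_nonneg_left (by positivity)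
  have hs0 : 0 < s := by linarith
  refine ⟨R + s, fun x hx => (maximalFunction_le_of_norm_le volume hG hx).trans ?_⟩
  -- `I ≤ volume (ball 0 s) * t`
  have hball : ENNReal.ofReal s * V ≤ volume (ball (0 : EuclideanSpace ℝ (Fin d)) s) := by
    rw [Measure.addHaar_ball_of_pos volume _ hs0, finrank_euclideanSpace_fin]
    gcongr
    exact le_self_pow₀ hs1 hd.ne'
  have hIle : I ≤ volume (ball (0 : EuclideanSpace ℝ (Fin d)) s) * ENNReal.ofReal t := by
    calc I = ENNReal.ofReal I.toReal := (ENNReal.ofReal_toReal hI.ne).symm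
      _ ≤ ENNReal.ofReal (s * V.toReal * t) := by
          refine ENNReal.ofReal_le_ofReal ?_
          have : I.toReal / (t * V.toReal) * V.toReal * t = I.toReal := by
            field_simp
          calc I.toReal = I.toReal / (t * V.toReal) * V.toReal * t := this.symm
            _ ≤ s * V.toReal * t := by
                gcongr
                rw [hs]
                linarith
      _ = ENNReal.ofReal s * V * ENNReal.ofReal t := by
          rw [ENNReal.ofReal_mul (by positivity), ENNReal.ofReal_mul (by positivity),
            ENNReal.ofReal_toReal hVt]
      _ ≤ volume (ball (0 : EuclideanSpace ℝ (Fin d)) s) * ENNReal.ofReal t := by gcongr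
  have hB0 : volume (ball (0 : EuclideanSpace ℝ (Fin d)) s) ≠ 0 := (measure_ball_pos volume _ hs0).ne'
  have hBt : volume (ball (0 : EuclideanSpace ℝ (Fin d)) s) ≠ ⊤ := measure_ball_lt_top.ne
  calc (volume (ball (0 : EuclideanSpace ℝ (Fin d)) s))⁻¹ * I
      ≤ (volume (ball (0 : EuclideanSpace ℝ (Fin d)) s))⁻¹ *
          (volume (ball (0 : EuclideanSpace ℝ (Fin d)) s) * ENNReal.ofReal t) := by gcongr
    _ = ENNReal.ofReal t := by rw [← mul_assoc, ENNReal.inv_mul_cancel hB0 hBt, one_mul]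

/-- **The Lipschitz truncation of a test function at level `t`** (the Calderón–Zygmund
decomposition of a Sobolev function, here for `φ ∈ C_c^∞(ℝᵈ; ℂᵏ)`, `d ≥ 1`): with
`M = M(‖Dφ‖)` the maximal function of the gradient and `F = {M ≤ t}`, there is a decomposition
`φ = g + b` into compactly supported Lipschitz maps with `g = φ` on `F`,
`‖Dg‖ ≤ K = c_ext 2^{2d+6} t` everywhere, `Db = 0` a.e. on `F`, whence
`∫ ‖∂_l g‖² ≤ ∫_F ‖Dφ‖² + K² |Fᶜ|` and `∫ ‖∂_l b‖ ≤ ∫_{Fᶜ} ‖Dφ‖ + K |Fᶜ|`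
(`φ` is `2^{2d+6}t`-Lipschitz on `F` by the pointwise maximal inequality, `g` a Lipschitz
extension of `φ|_F`, `b = φ - g` vanishes on `F` and hence has a.e. vanishing gradient there;
`b` is compactly supported because `M ≤ t` far away).
[cite: Badr2009, §5 proof of Prop. 5.6 (the functions g and b)] -/
theorem exists_lipschitz_truncation (hd : 0 < d) {φ : EuclideanSpace ℝ (Fin d) → Fin k → ℂ}
    (hφ : ContDiff ℝ ∞ φ) (hφc : HasCompactSupport φ) {t : ℝ} (ht : 0 < t) :
    ∃ g b : EuclideanSpace ℝ (Fin d) → Fin k → ℂ, ∃ Kb : ℝ≥0,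
      LipschitzWith (lipschitzExtensionConstant (Fin k → ℂ) * (2 ^ (2 * d + 6) * t.toNNReal)) g ∧
      LipschitzWith Kb b ∧ HasCompactSupport g ∧ HasCompactSupport b ∧ φ = g + b ∧
      (∀ l, ∫⁻ x, ‖partialDeriv l g x‖ₑ ^ (2 : ℝ) ≤
        (∫⁻ x in {x | maximalFunction volume (fun w => ‖fderiv ℝ φ w‖ₑ) x ≤ ENNReal.ofReal t},
            ‖fderiv ℝ φ x‖ₑ ^ (2 : ℝ)) +
          ((lipschitzExtensionConstant (Fin k → ℂ) * (2 ^ (2 * d + 6) * t.toNNReal) : ℝ≥0) :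
              ℝ≥0∞) ^ (2 : ℝ) *
            volume {x | maximalFunction volume (fun w => ‖fderiv ℝ φ w‖ₑ) x ≤ ENNReal.ofReal t}ᶜ) ∧
      (∀ l, ∫⁻ x, ‖partialDeriv l b x‖ₑ ≤
        (∫⁻ x in {x | maximalFunction volume (fun w => ‖fderiv ℝ φ w‖ₑ) x ≤ ENNReal.ofReal t}ᶜ,
            ‖fderiv ℝ φ x‖ₑ) +
          ((lipschitzExtensionConstant (Fin k → ℂ) * (2 ^ (2 * d + 6) * t.toNNReal) : ℝ≥0) :
              ℝ≥0∞) *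
            volume {x | maximalFunction volume (fun w => ‖fderiv ℝ φ w‖ₑ) x ≤ ENNReal.ofReal t}ᶜ) := by
  set G : EuclideanSpace ℝ (Fin d) → ℝ≥0∞ := fun w => ‖fderiv ℝ φ w‖ₑ with hG
  set F : Set (EuclideanSpace ℝ (Fin d)) :=
    {x | maximalFunction volume G x ≤ ENNReal.ofReal t} with hF
  set L : ℝ≥0 := 2 ^ (2 * d + 6) * t.toNNReal with hL
  set Kg : ℝ≥0 := lipschitzExtensionConstant (Fin k → ℂ) * L with hKg
  have hφ1 : ContDiff ℝ 1 φ := hφ.of_le (mod_cast le_top)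
  have hφd : Differentiable ℝ φ := hφ1.differentiable one_ne_zero
  have hGc : Continuous fun w => fderiv ℝ φ w := hφ1.continuous_fderiv one_ne_zero
  have hGm : Measurable G := hGc.measurable.enorm
  have hFm : MeasurableSet F :=
    measurableSet_le (measurable_maximalFunction volume G) measurable_const
  -- `φ` is `L`-Lipschitz on `F`; extend
  have hLip : LipschitzOnWith L φ F := by
    have h := lipschitzOnWith_of_maximal_le (F := Fin k → ℂ) volume hφ1 t.toNNReal
    rw [finrank_euclideanSpace_fin] at h
    exact h
  obtain ⟨g, hgL, hgeq⟩ := hLip.extend_finite_dimension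
  set b : EuclideanSpace ℝ (Fin d) → Fin k → ℂ := φ - g with hb
  obtain ⟨Kφ, hφL⟩ := hφ.lipschitzWith_of_hasCompactSupport hφc (by simp)
  have hbL : LipschitzWith (Kφ + Kg) b := hφL.sub hgL
  have hbF : ∀ x ∈ F, b x = 0 := fun x hx => by
    simp only [hb, Pi.sub_apply, hgeq hx, sub_self]
  -- compact supports
  obtain ⟨R, hR⟩ : ∃ R, ∀ y : EuclideanSpace ℝ (Fin d), R < ‖y‖ → G y = 0 := by
    obtain ⟨R, hR⟩ := (hφc.fderiv ℝ).isCompact.isBounded.subset_closedBall 0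
    refine ⟨R, fun y hy => ?_⟩
    have hy' : y ∉ tsupport (fderiv ℝ φ) := fun h => by
      have := hR h
      rw [mem_closedBall, dist_zero_right] at this
      linarith
    simp only [hG, image_eq_zero_of_notMem_tsupport hy']
    rw [← ofReal_norm]
    simp
  have hI : ∫⁻ y, G y < ⊤ :=
    (hGc.integrable_of_hasCompactSupport (hφc.fderiv ℝ)).hasFiniteIntegral
  obtain ⟨R', hR'⟩ := exists_radius_maximalFunction_le hd hI hR ht
  have hbc : HasCompactSupport b := by
    refine HasCompactSupport.intro (isCompact_closedBall (0 : EuclideanSpace ℝ (Fin d)) R')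
      fun x hx => hbF x (hR' x ?_)
    rw [mem_closedBall, dist_zero_right, not_le] at hx
    exact hx.le
  have hgc : HasCompactSupport g := by
    have : g = φ - b := by simp only [hb, sub_sub_cancel]
    rw [this]
    exact hφc.sub hbc
  -- a.e. facts on the derivatives
  have hgd : ∀ᵐ x ∂(volume : Measure (EuclideanSpace ℝ (Fin d))), DifferentiableAt ℝ g x :=
    hgL.ae_differentiableAt
  have hzero : ∀ᵐ x ∂(volume : Measure (EuclideanSpace ℝ (Fin d))), b x = 0 → fderiv ℝ b x = 0 :=
    ae_fderiv_eq_zero_of_lipschitzWith volume hbL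
  have hnormg : ∀ x, ‖fderiv ℝ g x‖ ≤ Kg := fun x => norm_fderiv_le_of_lipschitz ℝ hgL
  have hnorme : ∀ l : Fin d, ‖(EuclideanSpace.single l (1 : ℝ) : EuclideanSpace ℝ (Fin d))‖ = 1 :=
    fun l => by simp
  have hval : ∀ x, G x ≤ maximalFunction volume G x := fun x =>
    le_maximalFunction_of_lowerSemicontinuous volume hGc.enorm.lowerSemicontinuous x
  -- pointwise a.e. bounds
  have hptg : ∀ l, ∀ᵐ x ∂(volume : Measure (EuclideanSpace ℝ (Fin d))),
      ‖partialDeriv l g x‖ₑ ^ (2 : ℝ) ≤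
        F.indicator (fun x => G x ^ (2 : ℝ)) x + Fᶜ.indicator (fun _ => (Kg : ℝ≥0∞) ^ (2 : ℝ)) x := by
    intro l
    filter_upwards [hgd, hzero] with x hgx hzx
    by_cases hx : x ∈ F
    · -- on `F`: `Dg = Dφ`
      have hbx : fderiv ℝ b x = 0 := hzx (hbF x hx)
      have hgφ : fderiv ℝ g x = fderiv ℝ φ x := by
        have h1 : fderiv ℝ b x = fderiv ℝ φ x - fderiv ℝ g x := by
          rw [hb, fderiv_sub (hφd x) hgx]
        rw [hbx] at h1
        exact (sub_eq_zero.1 h1.symm).symm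
      rw [indicator_of_mem hx, indicator_of_notMem (notMem_compl_iff.2 hx), add_zero]
      gcongr
      rw [partialDeriv_apply, hgφ]
      calc ‖fderiv ℝ φ x (EuclideanSpace.single l 1)‖ₑ
          ≤ ‖fderiv ℝ φ x‖ₑ * ‖(EuclideanSpace.single l (1 : ℝ) : EuclideanSpace ℝ (Fin d))‖ₑ :=
            ContinuousLinearMap.le_opENorm _ _
        _ = G x := by rw [← ofReal_norm (EuclideanSpace.single l 1), hnorme l, ENNReal.ofReal_one, mul_one]
    · rw [indicator_of_notMem hx, indicator_of_mem (mem_compl hx), zero_add]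
      gcongr
      rw [partialDeriv_apply, ← ofReal_norm, ← ENNReal.ofReal_coe_nnreal]
      refine ENNReal.ofReal_le_ofReal ?_
      calc ‖fderiv ℝ g x (EuclideanSpace.single l 1)‖
          ≤ ‖fderiv ℝ g x‖ * ‖(EuclideanSpace.single l (1 : ℝ) : EuclideanSpace ℝ (Fin d))‖ :=
            ContinuousLinearMap.le_opNorm _ _
        _ ≤ Kg := by rw [hnorme l, mul_one]; exact hnormg x
  have hptb : ∀ l, ∀ᵐ x ∂(volume : Measure (EuclideanSpace ℝ (Fin d))),
      ‖partialDeriv l b x‖ₑ ≤ Fᶜ.indicator (fun x => G x + Kg) x := by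
    intro l
    filter_upwards [hgd, hzero] with x hgx hzx
    by_cases hx : x ∈ F
    · rw [partialDeriv_apply, hzx (hbF x hx), zero_apply, enorm_zero]
      exact zero_le
    · rw [indicator_of_mem (mem_compl hx), partialDeriv_apply, hb, fderiv_sub (hφd x) hgx,
        sub_apply]
      refine enorm_sub_le.trans (add_le_add ?_ ?_)
      · calc ‖fderiv ℝ φ x (EuclideanSpace.single l 1)‖ₑ
            ≤ ‖fderiv ℝ φ x‖ₑ * ‖(EuclideanSpace.single l (1 : ℝ) : EuclideanSpace ℝ (Fin d))‖ₑ :=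
              ContinuousLinearMap.le_opENorm _ _
          _ = G x := by rw [← ofReal_norm (EuclideanSpace.single l 1), hnorme l, ENNReal.ofReal_one, mul_one]
      · rw [← ofReal_norm, ← ENNReal.ofReal_coe_nnreal]
        refine ENNReal.ofReal_le_ofReal ?_
        calc ‖fderiv ℝ g x (EuclideanSpace.single l 1)‖
            ≤ ‖fderiv ℝ g x‖ * ‖(EuclideanSpace.single l (1 : ℝ) : EuclideanSpace ℝ (Fin d))‖ :=
              ContinuousLinearMap.le_opNorm _ _
          _ ≤ Kg := by rw [hnorme l, mul_one]; exact hnormg x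
  -- integrate
  refine ⟨g, b, Kφ + Kg, hgL, hbL, hgc, hbc, by simp only [hb, add_sub_cancel], fun l => ?_, fun l => ?_⟩
  · calc ∫⁻ x, ‖partialDeriv l g x‖ₑ ^ (2 : ℝ)
        ≤ ∫⁻ x, F.indicator (fun x => G x ^ (2 : ℝ)) x + Fᶜ.indicator (fun _ => (Kg : ℝ≥0∞) ^ (2 : ℝ)) x :=
          lintegral_mono_ae (hptg l)
      _ = (∫⁻ x in F, G x ^ (2 : ℝ)) + (Kg : ℝ≥0∞) ^ (2 : ℝ) * volume Fᶜ := by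
          rw [lintegral_add_left ((hGm.pow_const _).indicator hFm), lintegral_indicator hFm,
            lintegral_indicator hFm.compl, setLIntegral_const]
  · calc ∫⁻ x, ‖partialDeriv l b x‖ₑ
        ≤ ∫⁻ x, Fᶜ.indicator (fun x => G x + Kg) x := lintegral_mono_ae (hptb l)
      _ = (∫⁻ x in Fᶜ, G x) + (Kg : ℝ≥0∞) * volume Fᶜ := by
          rw [lintegral_indicator hFm.compl, lintegral_add_left hGm, setLIntegral_const]

end Decomposition

/-! ### Assembly: the level-set integration -/

section Assembly

variable {d k k' : ℕ}

/-- `‖L‖ ≤ Σ_l ‖L e_l‖` for a continuous linear map on `ℝᵈ` (expand `v = Σ v_l e_l` and use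
`|v_l| ≤ ‖v‖`). [folklore] -/
theorem opNorm_le_sum_norm_apply_euclideanSingle {F : Type*} [NormedAddCommGroup F] [NormedSpace ℝ F]
    (L : EuclideanSpace ℝ (Fin d) →L[ℝ] F) :
    ‖L‖ ≤ ∑ l, ‖L (EuclideanSpace.single l 1)‖ := by
  refine ContinuousLinearMap.opNorm_le_bound _ (Finset.sum_nonneg fun _ _ => norm_nonneg _)
    fun v => ?_
  have hv : L v = ∑ l, v l • L (EuclideanSpace.single l (1 : ℝ)) := by
    conv_lhs => rw [← (EuclideanSpace.basisFun (Fin d) ℝ).sum_repr v]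
    simp only [map_sum, map_smul, EuclideanSpace.basisFun_repr, EuclideanSpace.basisFun_apply]
  calc ‖L v‖ = ‖∑ l, v l • L (EuclideanSpace.single l 1)‖ := by rw [hv]
    _ ≤ ∑ l, ‖v l • L (EuclideanSpace.single l 1)‖ := norm_sum_le _ _
    _ ≤ ∑ l, ‖L (EuclideanSpace.single l 1)‖ * ‖v‖ := Finset.sum_le_sum fun l _ => by
        rw [norm_smul, mul_comm]
        exact mul_le_mul_of_nonneg_left (by simpa using PiLp.norm_apply_le v l) (norm_nonneg _)
    _ = (∑ l, ‖L (EuclideanSpace.single l 1)‖) * ‖v‖ := (Finset.sum_mul _ _ _).symm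

/-- `‖Dφ‖_{Lᵖ} ≤ Σ_l ‖∂_lφ‖_{Lᵖ}` for a `C¹` map on `ℝᵈ`, `1 ≤ p`. [folklore] -/
theorem eLpNorm_fderiv_le_sum_partialDeriv {F : Type*} [NormedAddCommGroup F] [NormedSpace ℝ F]
    {φ : EuclideanSpace ℝ (Fin d) → F} (hφ : ContDiff ℝ 1 φ) {p : ℝ≥0∞} (hp : 1 ≤ p) :
    eLpNorm (fun x => fderiv ℝ φ x) p volume ≤ ∑ l, eLpNorm (partialDeriv l φ) p volume := by
  have hc : Continuous fun x => fderiv ℝ φ x := hφ.continuous_fderiv one_ne_zero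
  calc eLpNorm (fun x => fderiv ℝ φ x) p volume
      ≤ eLpNorm (∑ l, fun x => ‖partialDeriv l φ x‖) p volume := by
        refine eLpNorm_mono fun x => ?_
        rw [Finset.sum_apply, Real.norm_of_nonneg (Finset.sum_nonneg fun _ _ => norm_nonneg _)]
        exact opNorm_le_sum_norm_apply_euclideanSingle _
    _ ≤ ∑ l, eLpNorm (fun x => ‖partialDeriv l φ x‖) p volume :=
        eLpNorm_sum_le (fun l _ => ((hc.clm_apply continuous_const).norm).aestronglyMeasurable) hp
    _ = ∑ l, eLpNorm (partialDeriv l φ) p volume := Finset.sum_congr rfl fun l _ => eLpNorm_norm _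

/-- **The core `Lᵖ` estimate, `1 < q < 2`, in dimension `d ≥ 1`.** For a bounded measurable
symbol with the `Ẇ^{1,1}` and `Ẇ^{1,2}` bounds there is a finite constant `C` with
`∫ |M(D)∂ⱼφ|^q ≤ C ∫ ‖Dφ‖^q` for all `φ ∈ C_c^∞` and all `j`: level-set integration of the
weak-type splitting applied to the Lipschitz truncation at every level `t`, and the two Tonelli
computations of the Marcinkiewicz argument plus the maximal theorem. [folklore] -/
theorem lintegral_rpow_multiplierOp_partialDeriv_le (hd : 0 < d)
    {M : EuclideanSpace ℝ (Fin d) → Matrix (Fin k') (Fin k) ℂ}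
    (hM : ∀ a b, Measurable fun ξ => M ξ a b) {C₀ : ℝ} (hC0 : 0 ≤ C₀)
    (hC : ∀ ξ a b, ‖M ξ a b‖ ≤ C₀) {c₁ c₂ : ℝ≥0}
    (h₁ : HasGradientLpBoundWith 1 c₁ M) (h₂ : HasGradientLpBoundWith 2 c₂ M)
    {q : ℝ} (hq1 : 1 < q) (hq2 : q < 2) :
    ∃ C : ℝ≥0∞, C < ⊤ ∧ ∀ φ : EuclideanSpace ℝ (Fin d) → Fin k → ℂ, ContDiff ℝ ∞ φ →
      HasCompactSupport φ → ∀ j : Fin d,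
        ∫⁻ x, ‖multiplierOp M (partialDeriv j φ) x‖ₑ ^ q ≤ C * ∫⁻ x, ‖fderiv ℝ φ x‖ₑ ^ q := by
  have hq0 : 0 < q := zero_lt_one.trans hq1
  -- constants
  set Kc : ℝ≥0 := lipschitzExtensionConstant (Fin k → ℂ) * 2 ^ (2 * d + 6) with hKc
  set CM : ℝ≥0∞ := ENNReal.ofReal q * (2 * 5 ^ Module.finrank ℝ (EuclideanSpace ℝ (Fin d))) *
    ((2 : ℝ≥0∞) ^ (q - 1) / ENNReal.ofReal (q - 1)) with hCM
  have hCMtop : CM < ⊤ := maximalLpConst_lt_top _ hq1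
  set K₁ : ℝ≥0∞ := 9 * ((c₂ : ℝ≥0∞) * d) ^ 2 with hK₁
  set K₃ : ℝ≥0∞ := 3 * ((c₁ : ℝ≥0∞) * d) with hK₃
  set K₂ : ℝ≥0∞ := K₁ * (Kc : ℝ≥0∞) ^ 2 + K₃ * Kc with hK₂
  have hcd₂ : (c₂ : ℝ≥0∞) * d < ⊤ := ENNReal.mul_lt_top ENNReal.coe_lt_top (ENNReal.natCast_lt_top d)
  have hcd₁ : (c₁ : ℝ≥0∞) * d < ⊤ := ENNReal.mul_lt_top ENNReal.coe_lt_top (ENNReal.natCast_lt_top d)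
  have hK₁top : K₁ < ⊤ := ENNReal.mul_lt_top (by norm_num) (ENNReal.pow_lt_top hcd₂)
  have hK₃top : K₃ < ⊤ := ENNReal.mul_lt_top (by norm_num) hcd₁
  have hK₂top : K₂ < ⊤ := ENNReal.add_lt_top.2
    ⟨ENNReal.mul_lt_top hK₁top (ENNReal.pow_lt_top ENNReal.coe_lt_top),
      ENNReal.mul_lt_top hK₃top ENNReal.coe_lt_top⟩
  refine ⟨ENNReal.ofReal q * K₁ * ENNReal.ofReal (2 - q)⁻¹ + K₂ * CM +
    ENNReal.ofReal q * K₃ * ENNReal.ofReal (q - 1)⁻¹ * CM, ?_, fun φ hφ hφc j => ?_⟩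
  · refine ENNReal.add_lt_top.2 ⟨ENNReal.add_lt_top.2 ⟨?_, ENNReal.mul_lt_top hK₂top hCMtop⟩,
      ENNReal.mul_lt_top (ENNReal.mul_lt_top (ENNReal.mul_lt_top ENNReal.ofReal_lt_top hK₃top)
        ENNReal.ofReal_lt_top) hCMtop⟩
    exact ENNReal.mul_lt_top (ENNReal.mul_lt_top ENNReal.ofReal_lt_top hK₁top) ENNReal.ofReal_lt_top
  -- the sizes
  set w : EuclideanSpace ℝ (Fin d) → Fin k' → ℂ := multiplierOp M (partialDeriv j φ) with hw
  set G : EuclideanSpace ℝ (Fin d) → ℝ≥0∞ := fun x => ‖fderiv ℝ φ x‖ₑ with hG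
  set Dr : EuclideanSpace ℝ (Fin d) → ℝ := fun x => ‖fderiv ℝ φ x‖ with hDr
  set Mf : EuclideanSpace ℝ (Fin d) → ℝ≥0∞ := maximalFunction volume G with hMf
  set m : EuclideanSpace ℝ (Fin d) → ℝ := fun x => (Mf x).toReal with hm
  have hφ1 : ContDiff ℝ 1 φ := hφ.of_le (mod_cast le_top)
  have hGc : Continuous fun x => fderiv ℝ φ x := hφ1.continuous_fderiv one_ne_zero
  have hDrc : Continuous Dr := hGc.norm
  have hDrm : Measurable Dr := hDrc.measurable
  have hDr0 : ∀ x, 0 ≤ Dr x := fun x => norm_nonneg _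
  have hGm : Measurable G := hGc.measurable.enorm
  have hGD : ∀ x, G x = ENNReal.ofReal (Dr x) := fun x => (ofReal_norm _).symm
  -- `Mf` is finite and dominates `G`
  obtain ⟨B, hB⟩ := (hφc.fderiv ℝ).exists_bound_of_continuous hGc
  have hMfle : ∀ x, Mf x ≤ ENNReal.ofReal B := fun x =>
    maximalFunction_le_of_ae_le volume (Eventually.of_forall fun y => by
      rw [hGD]; exact ENNReal.ofReal_le_ofReal (hB y)) x
  have hMftop : ∀ x, Mf x ≠ ⊤ := fun x => ne_top_of_le_ne_top ENNReal.ofReal_ne_top (hMfle x)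
  have hMfm : Measurable Mf := measurable_maximalFunction volume G
  have hmm : Measurable m := hMfm.ennreal_toReal
  have hm0 : ∀ x, 0 ≤ m x := fun x => ENNReal.toReal_nonneg
  have hMm : ∀ x, Mf x = ENNReal.ofReal (m x) := fun x => (ENNReal.ofReal_toReal (hMftop x)).symm
  have hGle : ∀ x, G x ≤ Mf x := fun x =>
    le_maximalFunction_of_lowerSemicontinuous volume hGc.enorm.lowerSemicontinuous x
  have hDm : ∀ x, Dr x ≤ m x := fun x => by
    have h := hGle x
    rw [hGD, hMm] at h
    exact (ENNReal.ofReal_le_ofReal_iff (hm0 x)).1 h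
  -- the level sets `{t < m}` are `{Mf ≤ t}ᶜ`
  have hlevel : ∀ {t : ℝ}, 0 < t → {x | Mf x ≤ ENNReal.ofReal t}ᶜ = {x | t < m x} := by
    intro t ht
    ext x
    simp only [mem_compl_iff, mem_setOf_eq, not_le]
    rw [hMm, ENNReal.ofReal_lt_ofReal_iff_of_nonneg ht.le]
  -- the three level functions
  set A : ℝ → ℝ≥0∞ := fun t => ∫⁻ x, {x | Dr x ≤ t}.indicator (fun x => ENNReal.ofReal (Dr x ^ (2 : ℝ))) x
    with hA
  set Bf : ℝ → ℝ≥0∞ := fun t => volume {x | t < m x} with hBf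
  set Cf : ℝ → ℝ≥0∞ := fun t => ∫⁻ x, {x | t < m x}.indicator (fun x => ENNReal.ofReal (m x)) x
    with hCf
  have hAmono : Monotone A := fun t₁ t₂ h => lintegral_mono fun x =>
    indicator_le_indicator_of_subset (fun x (hx : Dr x ≤ t₁) => hx.trans h) (fun _ => zero_le) x
  have hBanti : Antitone Bf := fun t₁ t₂ h => measure_mono fun x (hx : t₂ < m x) => h.trans_lt hx
  have hCanti : Antitone Cf := fun t₁ t₂ h => lintegral_mono fun x =>
    indicator_le_indicator_of_subset (fun x (hx : t₂ < m x) => h.trans_lt hx) (fun _ => zero_le) x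
  -- the weak-type bound at level `t`
  have hweak : ∀ t, 0 < t → volume {x | t < ‖w x‖} ≤
      ENNReal.ofReal ((3 / t) ^ 2) * (((c₂ : ℝ≥0∞) * d) ^ (2 : ℝ) *
          (A t + ((Kc : ℝ≥0∞) * ENNReal.ofReal t) ^ (2 : ℝ) * Bf t)) +
        ENNReal.ofReal (3 / t) * (((c₁ : ℝ≥0∞) * d) *
          (Cf t + (Kc : ℝ≥0∞) * ENNReal.ofReal t * Bf t)) := by
    intro t ht
    obtain ⟨g, b, Kb, hgL, hbL, hgc, hbc, hsum, hgi, hbi⟩ := exists_lipschitz_truncation hd hφ hφc ht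
    have hW := measure_lt_norm_multiplierOp_partialDeriv_le hM hC0 hC h₁ h₂ hφ hφc hgL hbL hgc hbc
      hsum j ht
    -- rewrite the constants
    have hεinv : (ENNReal.ofReal t / 3)⁻¹ = ENNReal.ofReal (3 / t) := by
      rw [show (3 : ℝ≥0∞) = ENNReal.ofReal 3 by simp, ← ENNReal.ofReal_div_of_pos (by norm_num),
        ← ENNReal.ofReal_inv_of_pos (show (0 : ℝ) < t / 3 by positivity), inv_div]
    have hKt : ((lipschitzExtensionConstant (Fin k → ℂ) * (2 ^ (2 * d + 6) * t.toNNReal) : ℝ≥0) :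
        ℝ≥0∞) = (Kc : ℝ≥0∞) * ENNReal.ofReal t := by
      rw [hKc, ← mul_assoc, ENNReal.coe_mul]
      rfl
    have hFset : {x | maximalFunction volume (fun w => ‖fderiv ℝ φ w‖ₑ) x ≤ ENNReal.ofReal t} =
        {x | Mf x ≤ ENNReal.ofReal t} := rfl
    rw [hFset, hKt] at hgi hbi
    rw [hlevel ht] at hgi hbi
    -- the `L²` sum
    have hg2 : ∀ l, eLpNorm (partialDeriv l g) 2 volume ≤
        (A t + ((Kc : ℝ≥0∞) * ENNReal.ofReal t) ^ (2 : ℝ) * Bf t) ^ (1 / (2 : ℝ)) := by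
      intro l
      rw [eLpNorm_eq_lintegral_rpow_enorm_toReal two_ne_zero ENNReal.ofNat_ne_top, ENNReal.toReal_ofNat]
      gcongr
      refine (hgi l).trans (add_le_add ?_ le_rfl)
      calc ∫⁻ x in {x | Mf x ≤ ENNReal.ofReal t}, ‖fderiv ℝ φ x‖ₑ ^ (2 : ℝ)
          = ∫⁻ x, {x | Mf x ≤ ENNReal.ofReal t}.indicator (fun x => G x ^ (2 : ℝ)) x :=
            (lintegral_indicator (measurableSet_le hMfm measurable_const) _).symm
        _ ≤ A t := by
            have hfun : (fun x => G x ^ (2 : ℝ)) = fun x => ENNReal.ofReal (Dr x ^ (2 : ℝ)) :=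
              funext fun x => by rw [hGD, ENNReal.ofReal_rpow_of_nonneg (hDr0 x) (by norm_num)]
            rw [hfun]
            refine lintegral_mono fun x => ?_
            refine indicator_le_indicator_of_subset (fun x (hx : Mf x ≤ ENNReal.ofReal t) => ?_)
              (fun _ => zero_le) x
            show Dr x ≤ t
            have := (hGle x).trans hx
            rw [hGD] at this
            exact (ENNReal.ofReal_le_ofReal_iff ht.le).1 this
    have hsum2 : (c₂ : ℝ≥0∞) * ∑ l, eLpNorm (partialDeriv l g) 2 volume ≤
        ((c₂ : ℝ≥0∞) * d) * (A t + ((Kc : ℝ≥0∞) * ENNReal.ofReal t) ^ (2 : ℝ) * Bf t) ^ (1 / (2 : ℝ)) := by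
      rw [mul_assoc]
      gcongr
      calc ∑ l, eLpNorm (partialDeriv l g) 2 volume
          ≤ ∑ l : Fin d, (A t + ((Kc : ℝ≥0∞) * ENNReal.ofReal t) ^ (2 : ℝ) * Bf t) ^ (1 / (2 : ℝ)) :=
            Finset.sum_le_sum fun l _ => hg2 l
        _ = d * (A t + ((Kc : ℝ≥0∞) * ENNReal.ofReal t) ^ (2 : ℝ) * Bf t) ^ (1 / (2 : ℝ)) := by
            rw [Finset.sum_const, Finset.card_univ, Fintype.card_fin, nsmul_eq_mul]
    -- the `L¹` sum
    have hsum1 : (c₁ : ℝ≥0∞) * ∑ l, eLpNorm (partialDeriv l b) 1 volume ≤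
        ((c₁ : ℝ≥0∞) * d) * (Cf t + (Kc : ℝ≥0∞) * ENNReal.ofReal t * Bf t) := by
      rw [mul_assoc]
      gcongr
      calc ∑ l, eLpNorm (partialDeriv l b) 1 volume
          ≤ ∑ l : Fin d, (Cf t + (Kc : ℝ≥0∞) * ENNReal.ofReal t * Bf t) := by
            refine Finset.sum_le_sum fun l _ => ?_
            rw [eLpNorm_one_eq_lintegral_enorm]
            refine (hbi l).trans (add_le_add ?_ le_rfl)
            calc ∫⁻ x in {x | t < m x}, ‖fderiv ℝ φ x‖ₑ
                = ∫⁻ x, {x | t < m x}.indicator G x :=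
                  (lintegral_indicator (measurableSet_lt measurable_const hmm) _).symm
              _ ≤ Cf t := by
                  refine lintegral_mono fun x => ?_
                  refine indicator_le_indicator ?_
                  rw [hGD]
                  exact ENNReal.ofReal_le_ofReal (hDm x)
        _ = d * (Cf t + (Kc : ℝ≥0∞) * ENNReal.ofReal t * Bf t) := by
            rw [Finset.sum_const, Finset.card_univ, Fintype.card_fin, nsmul_eq_mul]
    -- combine
    rw [hεinv] at hW
    refine hW.trans (add_le_add ?_ ?_)
    · rw [ENNReal.ofReal_rpow_of_nonneg (by positivity) (by norm_num), Real.rpow_two]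
      gcongr
      calc ((c₂ : ℝ≥0∞) * ∑ l, eLpNorm (partialDeriv l g) 2 volume) ^ (2 : ℝ)
          ≤ (((c₂ : ℝ≥0∞) * d) * (A t + ((Kc : ℝ≥0∞) * ENNReal.ofReal t) ^ (2 : ℝ) * Bf t) ^
              (1 / (2 : ℝ))) ^ (2 : ℝ) := by gcongr
        _ = ((c₂ : ℝ≥0∞) * d) ^ (2 : ℝ) *
              (A t + ((Kc : ℝ≥0∞) * ENNReal.ofReal t) ^ (2 : ℝ) * Bf t) := by
            rw [ENNReal.mul_rpow_of_nonneg _ _ (by norm_num), ← ENNReal.rpow_mul,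
              one_div_mul_cancel (by norm_num : (2 : ℝ) ≠ 0), ENNReal.rpow_one]
    · gcongr
  -- multiply by `t^{q-1}` and simplify the powers of `t`
  have hweak' : ∀ t, 0 < t → volume {x | t < ‖w x‖} * ENNReal.ofReal (t ^ (q - 1)) ≤
      K₁ * (ENNReal.ofReal (t ^ (q - 1 - 2)) * A t) + K₂ * (Bf t * ENNReal.ofReal (t ^ (q - 1))) +
        K₃ * (ENNReal.ofReal (t ^ (q - 2)) * Cf t) := by
    intro t ht
    have hw2 := hweak t ht
    simp only [ENNReal.rpow_two] at hw2
    have r₁ : (3 / t) ^ 2 * t ^ (q - 1) = 9 * t ^ (q - 1 - 2) := by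
      rw [Real.rpow_sub ht (q - 1) 2, Real.rpow_two]
      field_simp
      norm_num
    have r₂ : (3 / t) ^ 2 * t ^ 2 = 9 := by
      field_simp
      norm_num
    have r₃ : 3 / t * t ^ (q - 1) = 3 * t ^ (q - 2) := by
      rw [show q - 2 = (q - 1) - 1 by ring, Real.rpow_sub ht (q - 1) 1, Real.rpow_one]
      field_simp
    have r₄ : 3 / t * t = 3 := by field_simp
    have e₁ : ENNReal.ofReal ((3 / t) ^ 2) * ENNReal.ofReal (t ^ (q - 1)) =
        9 * ENNReal.ofReal (t ^ (q - 1 - 2)) := by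
      rw [← ENNReal.ofReal_mul (by positivity), r₁, ENNReal.ofReal_mul (by norm_num),
        ENNReal.ofReal_ofNat]
    have e₂ : ENNReal.ofReal ((3 / t) ^ 2) * (ENNReal.ofReal t) ^ 2 *
        ENNReal.ofReal (t ^ (q - 1)) = 9 * ENNReal.ofReal (t ^ (q - 1)) := by
      rw [← ENNReal.ofReal_pow ht.le, ← ENNReal.ofReal_mul (by positivity), r₂, ENNReal.ofReal_ofNat]
    have e₃ : ENNReal.ofReal (3 / t) * ENNReal.ofReal (t ^ (q - 1)) =
        3 * ENNReal.ofReal (t ^ (q - 2)) := by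
      rw [← ENNReal.ofReal_mul (by positivity), r₃, ENNReal.ofReal_mul (by norm_num),
        ENNReal.ofReal_ofNat]
    have e₄ : ENNReal.ofReal (3 / t) * ENNReal.ofReal t * ENNReal.ofReal (t ^ (q - 1)) =
        3 * ENNReal.ofReal (t ^ (q - 1)) := by
      rw [← ENNReal.ofReal_mul (by positivity), r₄, ENNReal.ofReal_ofNat]
    calc volume {x | t < ‖w x‖} * ENNReal.ofReal (t ^ (q - 1))
        ≤ (ENNReal.ofReal ((3 / t) ^ 2) * (((c₂ : ℝ≥0∞) * d) ^ 2 *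
            (A t + ((Kc : ℝ≥0∞) * ENNReal.ofReal t) ^ 2 * Bf t)) +
          ENNReal.ofReal (3 / t) * (((c₁ : ℝ≥0∞) * d) *
            (Cf t + (Kc : ℝ≥0∞) * ENNReal.ofReal t * Bf t))) * ENNReal.ofReal (t ^ (q - 1)) := by
          gcongr
      _ = ((c₂ : ℝ≥0∞) * d) ^ 2 *
              (ENNReal.ofReal ((3 / t) ^ 2) * ENNReal.ofReal (t ^ (q - 1))) * A t +
            ((c₂ : ℝ≥0∞) * d) ^ 2 * (Kc : ℝ≥0∞) ^ 2 *
              (ENNReal.ofReal ((3 / t) ^ 2) * (ENNReal.ofReal t) ^ 2 *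
                ENNReal.ofReal (t ^ (q - 1))) * Bf t +
            ((c₁ : ℝ≥0∞) * d) * (ENNReal.ofReal (3 / t) * ENNReal.ofReal (t ^ (q - 1))) * Cf t +
            ((c₁ : ℝ≥0∞) * d) * Kc *
              (ENNReal.ofReal (3 / t) * ENNReal.ofReal t * ENNReal.ofReal (t ^ (q - 1))) * Bf t := by
          ring
      _ = K₁ * (ENNReal.ofReal (t ^ (q - 1 - 2)) * A t) + K₂ * (Bf t * ENNReal.ofReal (t ^ (q - 1))) +
            K₃ * (ENNReal.ofReal (t ^ (q - 2)) * Cf t) := by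
          rw [e₁, e₂, e₃, e₄, hK₂, hK₁, hK₃]
          ring
  -- the three `t`-integrals
  have hI₁ : ∫⁻ t in Ioi (0 : ℝ), ENNReal.ofReal (t ^ (q - 1 - 2)) * A t =
      ENNReal.ofReal (2 - q)⁻¹ * ∫⁻ x, G x ^ q := by
    rw [hA, lintegral_rpow_mul_lintegral_indicator_le hDrm hDr0 hq0 hq2]
    congr 1
    exact lintegral_congr fun x => by rw [hGD, ENNReal.ofReal_rpow_of_nonneg (hDr0 x) hq0.le]
  have hmq : ∫⁻ x, ENNReal.ofReal (m x ^ q) = ∫⁻ x, Mf x ^ q :=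
    lintegral_congr fun x => by rw [hMm, ENNReal.ofReal_rpow_of_nonneg (hm0 x) hq0.le]
  have hI₂ : ENNReal.ofReal q * ∫⁻ t in Ioi (0 : ℝ), Bf t * ENNReal.ofReal (t ^ (q - 1)) =
      ∫⁻ x, Mf x ^ q := by
    rw [← hmq, lintegral_rpow_eq_lintegral_meas_lt_mul volume (Eventually.of_forall hm0)
      hmm.aemeasurable hq0]
  have hI₃ : ∫⁻ t in Ioi (0 : ℝ), ENNReal.ofReal (t ^ (q - 2)) * Cf t =
      ENNReal.ofReal (q - 1)⁻¹ * ∫⁻ x, Mf x ^ q := by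
    rw [hCf, lintegral_rpow_mul_lintegral_indicator_lt hmm hm0 hq1, hmq]
  -- the maximal theorem
  have hmax : ∫⁻ x, Mf x ^ q ≤ CM * ∫⁻ x, G x ^ q :=
    lintegral_maximalFunction_rpow_le volume hGm.aemeasurable hq1
  -- measurability of the integrands in `t`
  have hmeas₁ : Measurable fun t : ℝ => ENNReal.ofReal (t ^ (q - 1 - 2)) * A t :=
    (measurable_id.pow_const _).ennreal_ofReal.mul hAmono.measurable
  have hmeas₂ : Measurable fun t : ℝ => Bf t * ENNReal.ofReal (t ^ (q - 1)) :=
    hBanti.measurable.mul (measurable_id.pow_const _).ennreal_ofReal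
  have hmeas₃ : Measurable fun t : ℝ => ENNReal.ofReal (t ^ (q - 2)) * Cf t :=
    (measurable_id.pow_const _).ennreal_ofReal.mul hCanti.measurable
  -- the layer cake formula for `w`
  obtain ⟨S, hS⟩ := exists_schwartz_coe_eq_partialDeriv hφ hφc j
  have hwm : AEStronglyMeasurable w volume := by
    rw [hw, ← hS]
    exact (continuous_multiplierOp_schwartz hM hC0 hC S).aestronglyMeasurable
  have hcake : ∫⁻ x, ‖w x‖ₑ ^ q =
      ENNReal.ofReal q * ∫⁻ t in Ioi (0 : ℝ), volume {x | t < ‖w x‖} * ENNReal.ofReal (t ^ (q - 1)) := by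
    rw [← lintegral_rpow_eq_lintegral_meas_lt_mul volume (Eventually.of_forall fun x => norm_nonneg _)
      hwm.norm.aemeasurable hq0]
    exact lintegral_congr fun x => by
      rw [← ofReal_norm, ENNReal.ofReal_rpow_of_nonneg (norm_nonneg _) hq0.le]
  -- conclusion
  have hm12 : Measurable fun t : ℝ => K₁ * (ENNReal.ofReal (t ^ (q - 1 - 2)) * A t) +
      K₂ * (Bf t * ENNReal.ofReal (t ^ (q - 1))) := (hmeas₁.const_mul K₁).add (hmeas₂.const_mul K₂)
  have hm1 : Measurable fun t : ℝ => K₁ * (ENNReal.ofReal (t ^ (q - 1 - 2)) * A t) :=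
    hmeas₁.const_mul K₁
  calc ∫⁻ x, ‖w x‖ₑ ^ q
      = ENNReal.ofReal q * ∫⁻ t in Ioi (0 : ℝ), volume {x | t < ‖w x‖} * ENNReal.ofReal (t ^ (q - 1)) :=
        hcake
    _ ≤ ENNReal.ofReal q * ∫⁻ t in Ioi (0 : ℝ), (K₁ * (ENNReal.ofReal (t ^ (q - 1 - 2)) * A t) +
          K₂ * (Bf t * ENNReal.ofReal (t ^ (q - 1))) + K₃ * (ENNReal.ofReal (t ^ (q - 2)) * Cf t)) := by
        gcongr 1
        exact setLIntegral_mono' measurableSet_Ioi fun t ht => hweak' t ht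
    _ = ENNReal.ofReal q * (K₁ * ∫⁻ t in Ioi (0 : ℝ), ENNReal.ofReal (t ^ (q - 1 - 2)) * A t) +
          K₂ * (ENNReal.ofReal q * ∫⁻ t in Ioi (0 : ℝ), Bf t * ENNReal.ofReal (t ^ (q - 1))) +
          ENNReal.ofReal q * (K₃ * ∫⁻ t in Ioi (0 : ℝ), ENNReal.ofReal (t ^ (q - 2)) * Cf t) := by
        rw [lintegral_add_left hm12, lintegral_add_left hm1, lintegral_const_mul K₁ hmeas₁,
          lintegral_const_mul K₂ hmeas₂, lintegral_const_mul K₃ hmeas₃]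
        ring
    _ = ENNReal.ofReal q * K₁ * ENNReal.ofReal (2 - q)⁻¹ * (∫⁻ x, G x ^ q) +
          K₂ * (∫⁻ x, Mf x ^ q) +
          ENNReal.ofReal q * K₃ * ENNReal.ofReal (q - 1)⁻¹ * (∫⁻ x, Mf x ^ q) := by
        rw [hI₁, hI₂, hI₃]
        ring
    _ ≤ ENNReal.ofReal q * K₁ * ENNReal.ofReal (2 - q)⁻¹ * (∫⁻ x, G x ^ q) +
          K₂ * (CM * ∫⁻ x, G x ^ q) +
          ENNReal.ofReal q * K₃ * ENNReal.ofReal (q - 1)⁻¹ * (CM * ∫⁻ x, G x ^ q) := by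
        gcongr
    _ = (ENNReal.ofReal q * K₁ * ENNReal.ofReal (2 - q)⁻¹ + K₂ * CM +
          ENNReal.ofReal q * K₃ * ENNReal.ofReal (q - 1)⁻¹ * CM) * ∫⁻ x, G x ^ q := by
        ring

end Assembly

/-! ### The discharge -/

section Discharge

/-- **Interpolation of `Ẇ^{1,p}` bounds between `p = 1` and `p = 2`: discharge of the named
fact `gradientLpBound_interpolation`.** For a bounded, entrywise measurable matrix symbol `M` on
`ℝᵈ` with the `Ẇ^{1,1}` bound `c₁` and the `Ẇ^{1,2}` bound `c₂` on `C_c^∞` test functions,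
`M(D)` has an `Ẇ^{1,p}` bound for every `1 < p < 2` ("Interpolating, (5) is valid for `Lᵖ`,
`1 < p < 2`" [Rauch1986, p. 483]; the interpolation property of the homogeneous Sobolev spaces
[Badr2009, Thm 1.4, Cor. 5.9]). Proved here by the real-variable method behind [Badr2009, §5,
Prop. 5.6]: the Calderón–Zygmund decomposition (Lipschitz truncation) of the test function at
every level of the maximal function of its gradient (`exists_lipschitz_truncation`), the
weak-type splitting of `M(D)∂ⱼφ` into an `L²`-controlled good part and an `L¹`-controlled bad
part (`measure_lt_norm_multiplierOp_partialDeriv_le`), and the level-set integration of the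
Marcinkiewicz argument together with the maximal theorem
(`lintegral_rpow_multiplierOp_partialDeriv_le`); for `d = 0` the statement is empty.
[cite: Badr2009, Thm 1.4 and Cor. 5.9, §5 Prop. 5.6; Rauch1986, Proof of Theorem p. 483] -/
theorem gradientLpBound_interpolation_holds : gradientLpBound_interpolation := by
  intro d k k' M hM hbdd c₁ c₂ h₁ h₂ p hp1 hp2
  obtain ⟨C₀, hC⟩ := hbdd
  have hC' : ∀ ξ a b, ‖M ξ a b‖ ≤ max C₀ 0 := fun ξ a b => (hC ξ a b).trans (le_max_left _ _)
  have hC0 : (0 : ℝ) ≤ max C₀ 0 := le_max_right _ _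
  rcases Nat.eq_zero_or_pos d with hd | hd
  · subst hd
    exact ⟨0, fun φ hφ hc => ⟨(h₁ φ hφ hc).1, by simp⟩⟩
  · have hptop : p ≠ ⊤ := ne_top_of_lt hp2
    have hp0 : p ≠ 0 := (zero_lt_one.trans hp1).ne'
    have hq1 : 1 < p.toReal := by
      have := (ENNReal.toReal_lt_toReal ENNReal.one_ne_top hptop).2 hp1
      rwa [ENNReal.toReal_one] at this
    have hq2 : p.toReal < 2 := by
      have := (ENNReal.toReal_lt_toReal hptop ENNReal.ofNat_ne_top).2 hp2
      rwa [ENNReal.toReal_ofNat] at this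
    have hq0 : 0 < p.toReal := zero_lt_one.trans hq1
    obtain ⟨C, hCtop, hcore⟩ :=
      lintegral_rpow_multiplierOp_partialDeriv_le hd hM hC0 hC' h₁ h₂ hq1 hq2
    have hfin : (d : ℝ≥0∞) * C ^ (1 / p.toReal) ≠ ⊤ :=
      ENNReal.mul_ne_top (ENNReal.natCast_ne_top d)
        (ENNReal.rpow_ne_top_of_nonneg (by positivity) hCtop.ne)
    refine ⟨((d : ℝ≥0∞) * C ^ (1 / p.toReal)).toNNReal, fun φ hφ hc => ⟨(h₁ φ hφ hc).1, ?_⟩⟩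
    have hφ1 : ContDiff ℝ 1 φ := hφ.of_le (mod_cast le_top)
    have hX : eLpNorm (fun x => fderiv ℝ φ x) p volume ≤ ∑ l, eLpNorm (partialDeriv l φ) p volume :=
      eLpNorm_fderiv_le_sum_partialDeriv hφ1 hp1.le
    have hj : ∀ j : Fin d, eLpNorm (multiplierOp M (partialDeriv j φ)) p volume ≤
        C ^ (1 / p.toReal) * eLpNorm (fun x => fderiv ℝ φ x) p volume := by
      intro j
      rw [eLpNorm_eq_lintegral_rpow_enorm_toReal hp0 hptop,
        eLpNorm_eq_lintegral_rpow_enorm_toReal hp0 hptop,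
        ← ENNReal.mul_rpow_of_nonneg _ _ (by positivity)]
      gcongr
      exact hcore φ hφ hc j
    calc ∑ j, eLpNorm (multiplierOp M (partialDeriv j φ)) p volume
        ≤ ∑ j : Fin d, C ^ (1 / p.toReal) * eLpNorm (fun x => fderiv ℝ φ x) p volume :=
          Finset.sum_le_sum fun j _ => hj j
      _ = (d : ℝ≥0∞) * C ^ (1 / p.toReal) * eLpNorm (fun x => fderiv ℝ φ x) p volume := by
          rw [Finset.sum_const, Finset.card_univ, Fintype.card_fin, nsmul_eq_mul, mul_assoc]
      _ ≤ (d : ℝ≥0∞) * C ^ (1 / p.toReal) * ∑ l, eLpNorm (partialDeriv l φ) p volume := by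
          gcongr
      _ = ((((d : ℝ≥0∞) * C ^ (1 / p.toReal)).toNNReal : ℝ≥0) : ℝ≥0∞) *
            ∑ l, eLpNorm (partialDeriv l φ) p volume := by
          rw [ENNReal.coe_toNNReal hfin]

end Discharge

end Literature.Analysis.Fourier

end
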